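import Summits.BirchSwinnertonDyer.Rank1Residual.ManinAdditive.TwistOrbitManinStatements
import HarnessLib

/-!
# Twist-orbit transport of the Manin constant — FILE 2/3: Watkins' orbit degree identity at `(q*, q, q²)`
# (S-an-13 = THM B discharged from the tree) and its corollaries E-an-16 at `q ∈ {3, 5, 7}`

Part of the planner `bsd-f2-manin-an`'s kernel-checked HOME/an/Sketch-an4v5.lean 2d253c8874352f93 (§5), landed
verbatim by the cell's typer (T-an-6); see `TwistOrbitManinStatements.lean` for provenance and the statement
schemas. PROVED, no `sorry`, no conjecture tags.
-/

noncomputable section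

open scoped MatrixGroups ModularForm

open CongruenceSubgroup WeierstrassCurve
  Literature.NumberTheory.DiophantineGeometry
  Literature.NumberTheory.EllipticCurves
  Literature.NumberTheory.EllipticCurves.ModularForms

namespace Summit.BirchSwinnertonDyer.Rank1Residual.ManinAdditive
/-! ## §5 (g3, v2) — S-an-13 DISCHARGED from the tree at `(d, q, M) = (q*, q, q²)`, `q` odd prime

`OrbitDegreeManinIdentity (q*) q (q²)` is a THEOREM: both members are additive at `q` (`q² ∣ N`), so
`aₙ = 0` for `q ∣ n` on both sides (`LFunction_apply_eq_zero_of_not_good_of_not_mult`), Watkins'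
identity `deg'·c²·u² = q·deg·c'²` is the tree's `deg_mul_sq_mul_sq_eq_of_quadraticTwist_pStar`, and
`u² = 1` from `Δ(W') = d⁶Δ(W)`.  Hence **E-an-16 at `(q*, q, q²)` is conditional on E-an-12c ONLY**
(`maninEqOfNotDvdDegree_pStar`), in particular `ManinEqOfNotDvdDegree (-3) 3 9 ⟸ CommutingOrbitManinChain (-3) 3 9`. -/

section ThmB

open IsDedekindDomain IsDedekindDomain.HeightOneSpectrum NumberField Rat.HeightOneSpectrum

/-- `q² ∣ N(W)` ⇒ `W` is neither good nor multiplicative at `q` (`f_q ≥ 2`; pattern of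
`ManinConstantQuadraticTwistCremonaRangeProofs`). [folklore] -/
theorem not_good_and_not_mult_of_sq_dvd_conductorNorm (W : WeierstrassCurve ℚ) [W.IsElliptic]
    {q : ℕ} [Fact q.Prime] (hsq : q ^ 2 ∣ W.conductorNorm ℤ) :
    ¬ W.HasGoodReductionAtPrime q ∧ ¬ W.HasMultiplicativeReductionAtPrime q := by
  have hq : q.Prime := Fact.out
  set vq : HeightOneSpectrum ℤ := (primesEquiv (R := ℤ)).symm ⟨q, hq⟩ with hvq
  have hN0 : W.conductorNorm ℤ ≠ 0 := (conductorNorm_pos_holds W).ne'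
  have hfW : 2 ≤ W.conductorExponent vq := by
    rw [← factorization_conductorNorm_primesEquiv_symm W ⟨q, hq⟩]
    exact (hq.pow_dvd_iff_le_factorization hN0).mp hsq
  refine ⟨fun hg ↦ ?_, fun hmu ↦ ?_⟩
  · have h0 : W.conductorExponent vq = 0 := (conductorExponent_eq_zero_iff_holds vq W).mpr
      ((W.hasGoodReductionAtPrime_iff_hasGoodReductionAt_holds ⟨q, hq⟩).mp hg)
    omega
  · have h1 : W.conductorExponent vq = 1 := (conductorExponent_eq_one_iff_holds vq W).mpr
      ((W.hasMultiplicativeReductionAtPrime_iff_hasMultiplicativeReductionAt_holds ⟨q, hq⟩).mp hmu)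
    omega

/-- `u(C)² = 1` when `C • (W ⊗ χ_d) = W'` and `Δ(W') = d⁶ Δ(W)` (`Δ(C • X) = u⁻¹² Δ(X)`,
`Δ(W ⊗ χ_d) = d⁶ Δ(W)`). [folklore] -/
theorem u_sq_eq_one_of_smul_quadraticTwist_of_Δ {W W' : WeierstrassCurve ℚ} [W.IsElliptic]
    {d : ℚ} (hd : d ≠ 0) (C : VariableChange ℚ) (hC : C • W.quadraticTwist d = W')
    (hΔ : W'.Δ = d ^ 6 * W.Δ) : ((C.u : ℚ)) ^ 2 = 1 := by
  have h1 : W'.Δ = ((C.u⁻¹ : ℚˣ) : ℚ) ^ 12 * (d ^ 6 * W.Δ) := by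
    rw [← hC, variableChange_Δ, quadraticTwist_Δ]
  have hX : d ^ 6 * W.Δ ≠ 0 := mul_ne_zero (pow_ne_zero _ hd) W.isUnit_Δ.ne_zero
  have h12 : ((C.u⁻¹ : ℚˣ) : ℚ) ^ 12 = 1 := by
    have h := h1.symm.trans hΔ
    exact mul_right_cancel₀ hX (h.trans (one_mul _).symm)
  have h12' : ((C.u : ℚ)) ^ 12 = 1 := by
    rw [Units.val_inv_eq_inv_val, inv_pow, inv_eq_one] at h12
    exact h12
  have h6 : (((C.u : ℚ)) ^ 2) ^ 6 = 1 := by rw [← pow_mul]; exact h12'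
  exact (pow_eq_one_iff_of_nonneg (sq_nonneg _) (by norm_num)).mp h6

/-- Watkins' identity in the cell's integer shape, levels as variables (so that `N(W') = N(W)` can be
substituted). [cite: Watkins2002, §2.1 (p. 491)] -/
theorem deg_mul_c_sq_eq_of_pStar {W W' : WeierstrassCurve ℚ} [W.IsElliptic] [W'.IsElliptic]
    {N N' : ℕ} [NeZero N] [NeZero N'] (hNN : N' = N) {q : ℕ} [Fact q.Prime] (hq2 : q ≠ 2)
    (u : VariableChange ℚ) (hu : u • W.quadraticTwist (((-1 : ℤ) ^ (q / 2) * q : ℤ) : ℚ) = W')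
    (hW0 : ∀ n : ℕ, q ∣ n → W.LFunction n = 0) (hW'0 : ∀ n : ℕ, q ∣ n → W'.LFunction n = 0)
    (hu2 : (((u.u : ℚ)) : ℝ) ^ 2 = 1)
    (D : ModularParametrizationData W N) (D' : ModularParametrizationData W' N') :
    (D'.modularDegree : ℤ) * D.c ^ 2 = (q : ℤ) * D.modularDegree * D'.c ^ 2 := by
  subst hNN
  have key := ModularParametrizationData.deg_mul_sq_mul_sq_eq_of_quadraticTwist_pStar hq2 u hu hW0 hW'0 D D'
  rw [hu2, mul_one] at key
  have key' : (((D'.modularDegree : ℤ) * D.c ^ 2 : ℤ) : ℝ) = (((q : ℤ) * D.modularDegree * D'.c ^ 2 : ℤ) : ℝ) := by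
    push_cast
    simpa [ModularParametrizationData.modularDegree] using key
  exact_mod_cast key'

/-- **S-an-13 at `(q*, q, q²)` is a theorem of the tree.** [cite: Watkins2002, §2.1 (p. 491)] -/
theorem orbitDegreeManinIdentity_pStar {q : ℕ} (hq : q.Prime) (hq2 : q ≠ 2) :
    OrbitDegreeManinIdentity ((-1 : ℤ) ^ (q / 2) * q) q (q ^ 2) := by
  intro W W' _ _ _ _ _ _ u D D' hM hN hu hD hD' hΔ
  haveI : Fact q.Prime := ⟨hq⟩
  have hdZ : ((-1 : ℤ) ^ (q / 2) * q : ℤ) ≠ 0 :=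
    mul_ne_zero (pow_ne_zero _ (by norm_num)) (by exact_mod_cast hq.ne_zero)
  have hd0 : ((((-1 : ℤ) ^ (q / 2) * q : ℤ)) : ℚ) ≠ 0 := by exact_mod_cast hdZ
  obtain ⟨hngW, hnmW⟩ := not_good_and_not_mult_of_sq_dvd_conductorNorm W hM
  have hM' : q ^ 2 ∣ W'.conductorNorm ℤ := by rw [hN]; exact hM
  obtain ⟨hngW', hnmW'⟩ := not_good_and_not_mult_of_sq_dvd_conductorNorm W' hM'
  have hW0 : ∀ n : ℕ, q ∣ n → W.LFunction n = 0 := fun n hn ↦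
    W.LFunction_apply_eq_zero_of_not_good_of_not_mult q hngW hnmW hn
  have hW'0 : ∀ n : ℕ, q ∣ n → W'.LFunction n = 0 := fun n hn ↦
    W'.LFunction_apply_eq_zero_of_not_good_of_not_mult q hngW' hnmW' hn
  have hu2 : ((u.u : ℚ)) ^ 2 = 1 := u_sq_eq_one_of_smul_quadraticTwist_of_Δ hd0 u hu hΔ
  have hu2R : (((u.u : ℚ)) : ℝ) ^ 2 = 1 := by exact_mod_cast hu2
  exact deg_mul_c_sq_eq_of_pStar hN hq2 u hu hW0 hW'0 hu2R D D'

/-- **E-an-16 at `(q*, q, q²)` from E-an-12c ALONE** (`q` odd prime). -/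
theorem maninEqOfNotDvdDegree_pStar {q : ℕ} (hq : q.Prime) (hq2 : q ≠ 2)
    (hCh : CommutingOrbitManinChain ((-1 : ℤ) ^ (q / 2) * q) q (q ^ 2)) :
    ManinEqOfNotDvdDegree ((-1 : ℤ) ^ (q / 2) * q) q (q ^ 2) :=
  maninEqOfNotDvdDegree_of_chain _ _ hq hCh (orbitDegreeManinIdentity_pStar hq hq2)

/-- The `9 ‖ N` instance: `ManinEqOfNotDvdDegree (-3) 3 9 ⟸ CommutingOrbitManinChain (-3) 3 9`. -/
theorem maninEqOfNotDvdDegree_neg_three (hCh : CommutingOrbitManinChain (-3) 3 9) :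
    ManinEqOfNotDvdDegree (-3) 3 9 := by
  have h := maninEqOfNotDvdDegree_pStar Nat.prime_three (by norm_num)
  norm_num at h
  exact h hCh

/-- The `25 ∣ N` instance. -/
theorem maninEqOfNotDvdDegree_five (hCh : CommutingOrbitManinChain 5 5 25) :
    ManinEqOfNotDvdDegree 5 5 25 := by
  have h := maninEqOfNotDvdDegree_pStar (q := 5) (by norm_num) (by norm_num)
  norm_num at h
  exact h hCh

/-- The `49 ∣ N` instance. -/
theorem maninEqOfNotDvdDegree_neg_seven (hCh : CommutingOrbitManinChain (-7) 7 49) :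
    ManinEqOfNotDvdDegree (-7) 7 49 := by
  have h := maninEqOfNotDvdDegree_pStar (q := 7) (by norm_num) (by norm_num)
  norm_num at h
  exact h hCh

end ThmB

end Summit.BirchSwinnertonDyer.Rank1Residual.ManinAdditive

end
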